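/-
Copyright (c) 2026. All rights reserved.
Released under Apache 2.0 license as described in the file LICENSE.
-/
import Literature.MathematicalPhysics.QuantumFieldTheory.Balaban1983to89.B4Lemma22CrossSup

/-!
# B4 Lemma 2.2 (2.17), `q = p = ∞`, `n = 0,1`, FOR `G_k(□,Ã)` WITH THE LINEAGE'S STAIRCASE CONTOURS —
INVERTIBILITY AND CONTOUR HYPOTHESES DISCHARGED

[B4] = T. Bałaban, *(Higgs)₂,₃ quantum fields in a finite volume. III. Regularity and decay of lattice Green's
functions*, Commun. Math. Phys. **89** (1983) 571–597 (bib key `Balaban1983RegularityDecay`).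

## The printed step («» = quotation units, transcript-B4.md ll. 104–110, 131, 159–166)

Lemma 2.2, pp. 577–578: «Let a rectangular parallelepiped □ be a sum of few large blocks (e.g., as in the case of
the cubes □_j), and let Ã be a regular vector field configuration in the sense of Proposition I.2.1, constant in a
neighbourhood of the boundary of □. Then for e sufficiently small …» «and a constant c₂ depending on d, p₁, such
that (2.17) ‖G_k(□,Ã)f‖_q, ‖D^η_{Ã,μ}G_k(□,Ã)f‖_q, ‖G_k(□,Ã)D^{η*}_{Ã,μ}f‖_q ≤ c₂‖f‖_p for 1 ≤ p, q ≤ ∞,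
satisfying the condition 1/p − 1/p₁ ≤ 1/q ≤ 1/p with p₁ > d.» p. 579 (2.23): «A = A₀ + A', |A'|, |∂^η_μA'| ≤
c'e^{β−1}»;
p. 572 «Γ^{(k)}_{y,x}» (the contours from the block point to `x`); p. 581: «According to our assumptions Ã is
constant in a neighbourhood of boundary of □, and we choose A₀ equal to this constant. … Now using Lemma 2.2 for
G_k(□,A₀) and the decomposition D^η_Ã = U(A')D^η_{A₀} + F_{1,k}(A'), we have (2.33) … The inequality (2.17) is
proved in the same way.»

## What this file certifies (kernel form; the lineage's typed objects)

`B4Lemma22CrossSup.lemma22_17_sup_box` proves the sup clauses `n = 0,1` of (2.17) for the lineage's `G_k(□,Ã)`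
(`B4Lemma22ReduceZero.greenA` at `Ã = constBond A₀ + A'`) on a fine box for an ARBITRARY block embedding / contour
system ending at the averaged point, keeping as hypotheses the invertibility of `H_k(□,Ã)` and a contour smallness
`|κA'(Γ_{y,x})| ≤ τ`.  Here both are DISCHARGED for the lineage's own contour system — the corner embedding
`B4Lower18Regular.baseEmb` and the staircase contours `B4Lower18Regular.stairContour` («Γ^{(k)}_{y,x}»):
* §1 `stair_lsum_le`: the bond size bound `|κA'_b| ≤ θ/n` gives `|κA'(Γ_{y,x})| ≤ (d+1)θ` along every staircase
  (`abs_lsum_le`, `stairContour_nn`, `stairContour_length ≤ (d+1)n`);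
* §2 `lemma22_17_sup_stair`: invertibility from the tree's (1.8)/(2.15) positivity
  `B4Lower18Regular.green_box_l2_bound` (under its explicit smallness `ℓ²θ²(d+1)(1 + a_k(d+1)) ≤ min(2,a_k)/4`),
  `hend` from `stairContour_end`, `τ = (d+1)θ` from §1; the result is (2.17)_∞, `n = 0,1`, both derivative
  conventions (`D^η_{A₀,μ}` summed over `μ`, and `D^η_{Ã,μ}`), for `G_k(□,Ã)` with the staircase contours, from ONLY:
  the window `a ∈ [amin,aplus]`, `m² ∈ [0,m2plus]`, `k ≥ 1`; the (2.23)-type size bound `|κA'_b| ≤ θ/n` on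
  nearest-neighbour bonds, the derivative bound `|κ(A'(b') − A'(b))| ≤ θ'/n²` on consecutive parallel bonds, the
  boundary condition "`A' = 0` on the `μ`-bonds touching the `μ`-faces" («A' has a compact support in □»), and two
  explicit smallness inequalities in `θ, θ'` («for e sufficiently small»; in [B4] `θ, θ' = O(e^βc)`).
This closes the chain `B4Thm110ZeroBox*` → `B4Lemma22ReduceZero` → `B4Lemma22Reduce231` → `B4Lemma22ReduceDeriv`
→ `B4Lemma22PertVSup` → `B4Lemma22CrossSup` → this file: the `q = p = ∞`, `n = 0,1` clauses of Lemma 2.2 (2.17) for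
`G_k(□,Ã)` on boxes with every operator-side hypothesis discharged inside the lineage.

## Honest scope

(a) Only the sup clauses `n = 0,1` of (2.17) (no Hölder (2.16), no general `(p,q)`, no `n = 2`); boxes `□` only (no
torus `T_η`, no general region `Λ`); the block averages are the lineage's (corner-based staircases, p. 572 objects as
typed in `B4Lower18Regular`). (b) The (2.23)-type hypotheses are stated with free parameters `θ, θ'` and the two
smallness conditions are explicit and unoptimised (the second involves the constant `c` of the zero-field theory and
the running coefficient `a_k = B1.aSeq a L k`). (c) `A'` is [B4]'s `Ã − A₀` on the box; the relation of `Ã` to the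
original torus configuration (p. 576 (2.8)–(2.10)) is not part of this file. No manuscript step is used as a
hypothesis of a theorem claiming a printed conclusion; 0 cited facts; every theorem is proved from the lineage's
definitions.

v1.1 (DOCFIX, 2026-08-19, self-audit): the statement of Lemma 2.2 / (2.17) is now quoted verbatim (v1 carried a
paraphrase inside «»); no Lean statement or proof changed.
-/

namespace Literature.MathematicalPhysics.QuantumFieldTheory.Balaban1983to89.B4Lemma22SupStair

open Finset Matrix
open Literature.MathematicalPhysics.QuantumFieldTheory.Balaban1983to89.B4GaugeCovariance (OrthFlow fieldLink boxWt
  blkWt constBond pathEnd)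
open Literature.MathematicalPhysics.QuantumFieldTheory.Balaban1983to89.B4Lower18Regular (e1 lsum abs_lsum_le baseEmb
  stairContour stairContour_end stairContour_nn stairContour_length green_box_l2_bound)
open Literature.MathematicalPhysics.QuantumFieldTheory.Balaban1983to89.B4Lemma21Region (siteNorm covDeriv)
open Literature.MathematicalPhysics.QuantumFieldTheory.Balaban1983to89.B4Reflection242 (nbrs boxDom)
open Literature.MathematicalPhysics.QuantumFieldTheory.Balaban1983to89.B4Lemma22Reduce231 (supN)
open Literature.MathematicalPhysics.QuantumFieldTheory.Balaban1983to89.B4Lemma22ReduceZero (Box greenA opA derivA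
  derivA0)
open Literature.MathematicalPhysics.QuantumFieldTheory.Balaban1983to89.B4Lemma22CrossSup (lemma22_17_sup_box)

noncomputable section

variable {ι : Type} [Fintype ι] [DecidableEq ι]

section Stair

variable {d : ℕ}

/-! ## §1 CONTOUR SMALLNESS ALONG THE STAIRCASES FROM THE BOND SIZE BOUND -/

/-- `|κA'(Γ_{y,x})| ≤ (d+1)θ` for the staircase contours when `|κA'_b| ≤ θ/n` on nearest-neighbour bonds
(`|Γ_{y,x}| ≤ (d+1)n` steps, each a nearest-neighbour bond).
[cite: Balaban1983RegularityDecay, p. 572 «Γ^{(k)}_{y,x}», p. 579 (2.23)] -/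
theorem stair_lsum_le (κ : ℝ) {n : ℕ} (hn : 1 ≤ n) (M : Fin (d + 1) → ℕ)
    {A' : ↥(boxDom (fun i => n * M i)) → ↥(boxDom (fun i => n * M i)) → ℝ} {θ : ℝ} (hθ : 0 ≤ θ)
    (hA' : ∀ x y : ↥(boxDom (fun i => n * M i)), y.1 ∈ nbrs x.1 → |κ * A' x y| ≤ θ / n)
    (y : ↥(boxDom M)) (x : ↥(boxDom (fun i => n * M i))) :
    |κ * lsum A' (baseEmb hn M y) (stairContour hn M y x)| ≤ ((d : ℝ) + 1) * θ := by
  have h := abs_lsum_le (r := fun u v : ↥(boxDom (fun i => n * M i)) => v.1 ∈ nbrs u.1) (κ := κ) (B := A')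
    (ρ := θ / n) (fun u v huv => hA' u v huv) (baseEmb hn M y) (stairContour hn M y x)
    (stairContour_nn hn M y x)
  have hlen := stairContour_length hn M y x
  have hn' : (0 : ℝ) < n := by exact_mod_cast hn
  calc |κ * lsum A' (baseEmb hn M y) (stairContour hn M y x)|
      ≤ ((stairContour hn M y x).length : ℝ) * (θ / n) := h
    _ ≤ ((d : ℝ) + 1) * n * (θ / n) := mul_le_mul_of_nonneg_right hlen (div_nonneg hθ hn'.le)
    _ = ((d : ℝ) + 1) * θ := by field_simp

end Stair

section Main

/-! ## §2 LEMMA 2.2 (2.17)_∞, `n = 0,1`, FOR `G_k(□,Ã)` WITH STAIRCASE CONTOURS -/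

/-- **LEMMA 2.2 (2.17), `q = p = ∞`, `n = 0,1`, FOR [B4]'s `G_k(□,Ã)` ON A FINE BOX WITH THE STAIRCASE
CONTOURS — ALL OPERATOR-SIDE HYPOTHESES DISCHARGED.**  There is `c > 0` such that for all `k ≥ 1`, all
`a ∈ [amin,aplus]`, `m² ∈ [0,m2plus]`, all unit boxes `M` (fine box `Π[0,(ℓ+1)^kM_μ)`, `n = (ℓ+1)^k = η^{-1}`), all
constant `A₀` and all `A'` with `|κA'_b| ≤ θ/n` on nearest-neighbour bonds, `|κ(A'(b') − A'(b))| ≤ θ'/n²` on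
consecutive parallel bonds (both orientations), `A' = 0` on the `μ`-bonds touching the `μ`-faces, and the two
smallness conditions `ℓ²θ²(d+1)(1 + a_k(d+1)) ≤ min(2,a_k)/4`,
`(d+2)c((d+1)ℓ(θ+θ') + (d+1)ℓθ + (d+1)ℓ²θ² + a_kℓ(d+1)θ(2 + ℓ(d+1)θ)) ≤ 1/2`: for every `Φ`,
`‖GΦ‖_∞ + Σ_μ‖D^η_{A₀,μ}GΦ‖_∞ ≤ 2(d+2)c‖Φ‖_∞` and `‖D^η_{Ã,μ}GΦ‖_∞ ≤ (1+ℓθ)·2(d+2)c‖Φ‖_∞`, where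
`G = G_k(□,Ã)`, `Ã = A₀ + A'`, with the corner embedding and staircase contours of `B4Lower18Regular`.
[cite: Balaban1983RegularityDecay, Lemma 2.2 (2.17) p. 578; proof pp. 579–582] -/
theorem lemma22_17_sup_stair (F : OrthFlow ι) {ℓ₁ : ℝ} (hℓ₁ : 0 ≤ ℓ₁)
    (hLip : ∀ t (v : ι → ℝ), ((F.U t - 1) *ᵥ v) ⬝ᵥ ((F.U t - 1) *ᵥ v) ≤ (ℓ₁ * t) ^ 2 * (v ⬝ᵥ v))
    (κ : ℝ) (d ℓ : ℕ) (hℓ : 1 ≤ ℓ) (amin aplus m2plus : ℝ) (ha : 0 < amin) :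
    ∃ c : ℝ, 0 < c ∧ ∀ (k : ℕ), 1 ≤ k → ∀ (hn : 1 ≤ (ℓ + 1) ^ k) (a m2 : ℝ),
      amin ≤ a → a ≤ aplus → 0 ≤ m2 → m2 ≤ m2plus →
      ∀ (M : Fin (d + 1) → ℕ), (∀ i, 1 ≤ M i) →
      ∀ (A₀ : Fin (d + 1) → ℝ) (A' : ↥(Box d ℓ k M) → ↥(Box d ℓ k M) → ℝ) (θ θ' : ℝ),
        0 ≤ θ → (∀ x y : ↥(Box d ℓ k M), y.1 ∈ nbrs x.1 → |κ * A' x y| ≤ θ / ((ℓ + 1) ^ k : ℕ)) →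
        0 ≤ θ' → (∀ (x z y : ↥(Box d ℓ k M)) (μ : Fin (d + 1)), z.1 = x.1 + e1 μ → y.1 = z.1 + e1 μ →
          |κ * (A' y z - A' z x)| ≤ θ' / (((ℓ + 1) ^ k : ℕ) : ℝ) ^ 2 ∧
          |κ * (A' x z - A' z y)| ≤ θ' / (((ℓ + 1) ^ k : ℕ) : ℝ) ^ 2) →
        (∀ (x y : ↥(Box d ℓ k M)) (μ : Fin (d + 1)), y.1 = x.1 + e1 μ →
          (x.1 - e1 μ ∉ Box d ℓ k M ∨ y.1 + e1 μ ∉ Box d ℓ k M) → A' x y = 0 ∧ A' y x = 0) →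
        ℓ₁ ^ 2 * θ ^ 2 * ((d : ℝ) + 1) * (1 + B1.aSeq a ((ℓ : ℝ) + 1) k * ((d : ℝ) + 1))
          ≤ min 2 (B1.aSeq a ((ℓ : ℝ) + 1) k) / 4 →
        ((d : ℝ) + 2) * c * (((d : ℝ) + 1) * ℓ₁ * (θ + θ') + ((d : ℝ) + 1) * ℓ₁ * θ
          + ((d : ℝ) + 1) * ℓ₁ ^ 2 * θ ^ 2
          + B1.aSeq a ((ℓ : ℝ) + 1) k * (ℓ₁ * (((d : ℝ) + 1) * θ) * (2 + ℓ₁ * (((d : ℝ) + 1) * θ)))) ≤ 1 / 2 →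
        ∀ Φ : ↥(Box d ℓ k M) × ι → ℝ,
          supN (greenA d F κ ℓ k a m2 M (baseEmb hn M) (stairContour hn M) (constBond A₀ Subtype.val + A') *ᵥ Φ)
              + ∑ μ, supN (derivA0 d F κ ℓ k M A₀ μ
                  *ᵥ (greenA d F κ ℓ k a m2 M (baseEmb hn M) (stairContour hn M) (constBond A₀ Subtype.val + A')
                      *ᵥ Φ))
              ≤ 2 * (((d : ℝ) + 2) * c) * supN Φ ∧
          ∀ μ : Fin (d + 1),
            supN (derivA d F κ ℓ k M (constBond A₀ Subtype.val + A') μ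
                *ᵥ (greenA d F κ ℓ k a m2 M (baseEmb hn M) (stairContour hn M) (constBond A₀ Subtype.val + A')
                    *ᵥ Φ))
              ≤ (1 + ℓ₁ * θ) * (2 * (((d : ℝ) + 2) * c)) * supN Φ := by
  obtain ⟨c, hc, h⟩ := lemma22_17_sup_box F hℓ₁ hLip κ d ℓ hℓ amin aplus m2plus ha
  refine ⟨c, hc, ?_⟩
  intro k hk hn a m2 e1' e2 e3 e4 M hM A₀ A' θ θ' hθ hA' hθ' hder hbd hsm2 hsm Φ
  have hL : (1 : ℝ) < (ℓ : ℝ) + 1 := by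
    have : (1 : ℝ) ≤ ℓ := by exact_mod_cast hℓ
    linarith
  have hak : 0 < B1.aSeq a ((ℓ : ℝ) + 1) k := B1.aSeq_pos (lt_of_lt_of_le ha e1') hL hk
  have hpos : 0 < min 2 (B1.aSeq a ((ℓ : ℝ) + 1) k) / 4 + m2 := by
    have : 0 < min 2 (B1.aSeq a ((ℓ : ℝ) + 1) k) := lt_min two_pos hak
    linarith
  have hAd : ∀ x y : ↥(Box d ℓ k M), y.1 ∈ nbrs x.1 →
      |κ * ((constBond A₀ Subtype.val + A' : ↥(Box d ℓ k M) → ↥(Box d ℓ k M) → ℝ) x y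
        - constBond A₀ Subtype.val x y)| ≤ θ / ((ℓ + 1) ^ k : ℕ) := by
    intro x y hxy
    simpa only [Pi.add_apply, add_sub_cancel_left] using hA' x y hxy
  have hunit := (green_box_l2_bound F hℓ₁ hLip κ hn hak.le hpos M A₀ (A := constBond A₀ Subtype.val + A') hθ hAd
    hsm2 0).1
  have hτ : ∀ y x, blkWt ((ℓ + 1) ^ k) M (fun i => (ℓ + 1) ^ k * M i) y x ≠ 0 →
      |κ * lsum A' (baseEmb hn M y) (stairContour hn M y x)| ≤ ((d : ℝ) + 1) * θ :=
    fun y x _ => stair_lsum_le κ hn M hθ hA' y x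
  have hτ0 : 0 ≤ ((d : ℝ) + 1) * θ := by positivity
  exact h k hk a m2 e1' e2 e3 e4 M hM (baseEmb hn M) (stairContour hn M) (fun y x hw => stairContour_end hn M y x hw)
    A₀ A' θ θ' (((d : ℝ) + 1) * θ) hunit hθ hA' hθ' hder hbd hτ0 hτ hsm Φ

end Main

end

end Literature.MathematicalPhysics.QuantumFieldTheory.Balaban1983to89.B4Lemma22SupStair
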